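import Summits.BirchSwinnertonDyer.Rank1Residual.Additive.XGordRankOneZeroCyclotomicThreeLowerK
import Summits.BirchSwinnertonDyer.Rank1Residual.Additive.XGordRankZeroOneCyclotomicThreeLowerFacts
import Summits.BirchSwinnertonDyer.Rank1Residual.Additive.BranchPAdicGrossZagierUpperHalf
import Summits.BirchSwinnertonDyer.Rank1Residual.Additive.QuadraticTwistTypeG
import Literature.NumberTheory.EllipticCurves.Rank1Residual.Typed.WuthrichUpperBound
import Literature.NumberTheory.EllipticCurves.Rank1Residual.Typed.JointLower
import Literature.NumberTheory.EllipticCurves.AnalyticRankOrderProofs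
import HarnessLib

/-!
# (S8) from named facts + the typed inputs: `Typed.JointLowerBoundAt V W 3`, `Typed.MissingLowerBoundAt W 3`
# and `BSD(W,3)` on the O7-ord ∩ (G-ord, `e = 2`)@3 rows with `surj(3) ∧ ram(3)` — `W` additive of analytic
# rank ONE, twist `V = E♭` good ordinary of analytic rank ZERO — anomalous rows INCLUDED
# (cell `b2b-bsdres`, team n1011, seat p16; OWNERS row T-N11-GK3LOW, sub-target (S8))

HONEST FRAMING (cell `b2b-bsdres`, run/shared/lean/b2b/bsd-rank1-residual/, verbatim in every
file): the goal of the cell is to DELETE the COMBINATION-SHAPED residual classes of the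
Birch–Swinnerton-Dyer formula for ALL analytic-rank `≤ 1` elliptic curves over `ℚ` — "full BSD
formula for every rank `≤ 1` curve in class `C`" assembled STRICTLY from published theorems — so
that the rank-`≤ 1` remainder becomes exactly the CONSTRUCTION-SHAPED classes, which are TYPED
(missing-input `Prop`s), NOT attempted. This is not "finishing BSD". Team n1011 (N10 / N11 / O7),
seat p16: research route; the labels of X4 / X10 and the N10 / N11 / O7 marks are UNCHANGED by this
file; nothing is booked here (the referee rules on bookings); no Literature fact is minted.

Theorems only (no `def`, no `sorry`, no new named fact). Companion of
`XGordRankOneZeroCyclotomicThreeLowerK.lean` (core; mathematics in its module docstring), structured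
exactly like the ranks-`(1,0)` companion `XGordRankZeroOneCyclotomicThreeLowerFacts.lean`:
`K = CyclotomicField 3 ℚ`; DISCHARGED from named facts — `hTorK` (Kato 2004 Thm. 17.4 (3) over `K`,
torsion clause, image from `surj(3) ∧ ram(3)` of `W`), Milne (`hMilne`), the newform / periods (`hmodD`),
modularity, GZK, and — for `Typed.MissingLowerBoundAt W 3` — the UPPER half of the rank-ZERO good ordinary
twist `V` (Wuthrich 2014 Prop. 21, `hW`, image `surj(3)`); the certificate `[T¹]L₃(V,ω¹,T) ≠ 0` of the
core is DERIVED from Schneider's non-degeneracy `SchneiderConjecture Dh` through the Gross–Zagier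
identity (`L'(W,1) ≠ 0`, `leadingLCoeff_ne_zero_holds`). What is NOT discharged — explicit hypotheses of
every theorem below, per row `(V, C, Tr, Dh)`:
* `hLowK` — (⊇/K), the two-branch main-conjecture containment for `V` over `ℚ(√−3)` (section
  hypothesis, for every newform / period normalisation; PLAN §1.2 II.3's wall; NOT in print);
* `hS1K` — Schneider's rank-one leading term for `V_K` with the `K`-height restricting along the
  twisting transport `Tr` to `2·Dh` (reading: Greenberg LNM 1716 p. 110 + Delbourgo 2002 p. 39; the
  tree's fact `Greenberg1999.schneider_charCoeff_rankOne_quadraticBaseChange` pins the height on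
  `V(ℚ)` only, which is torsion here — NOT dischargeable from it);
* `hGZ : BranchPAdicGrossZagierOddAt W 3 Dh` — seat p01's typed `3`-adic Gross–Zagier (odd branch);
* `hS : SchneiderConjecture Dh` — p01's rider (non-degeneracy of the `3`-adic height on `W(ℚ)`).

## Results (`V` good ordinary at `3`, `r_an(V) = 0`; `W = C • V^{(−3)}` additive at `3`, `r_an(W) = 1`,
## `surj(3) ∧ ram(3)` for `W`)

* `XGordRankOneZeroCyclotomicThreeLowerK.jointLowerBoundAt_of_surj_of_ram` — **`Typed.JointLowerBoundAt V W 3`**: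
  `ord₃ #Ш_an(V) + ord₃ #Ш_an(W) ≤ ord₃ #Ш(V) + ord₃ #Ш(W)`;
* `…missingLowerBoundAt_of_surj_of_ram` — **`Typed.MissingLowerBoundAt W 3`**, the UPPER half of `V`
  DISCHARGED (Wuthrich 2014 Prop. 21);
* `…missingLowerBoundAt_twist_of_missingUpperBoundAt_of_surj_of_ram` — `Typed.MissingLowerBoundAt V 3` ⟸
  the UPPER half of `W` (hypothesis; seat p01's `ClassX4Gord.missingUpperBoundAt_rankOne_of_katoHalf_of_branchPAdicGrossZagierOdd`
  supplies it on X4♯(G-ord)@3 from Kato's half + a Delbourgo (B)-datum + the SAME typed GZ);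
* `…bsdp_three_and_twist_of_katoHalf_of_leadingTermClauses_of_surj_of_ram` — **`BSD(W,3) ∧ BSD(V,3)`** on
  X4♯(G-ord)@3 ∧ `surj ∧ ram`, `r_an(W) = 1`, `r_an(V) = 0`, EVERY ROW (anomalous included) ⟸ (⊇/K) +
  `hS1K` + `hGZ` + `hS` at a Delbourgo (B)-datum `Dh` (`LeadingTermClauses W 3 Dh`, supplied per row by
  `Delbourgo2002.mainTheorem_three` + ¬CM) + named facts — the IMC-version loop of route planner 3's
  O7-ord@3 matrix CLOSED on the ANOMALOUS (G-ord) cell too;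
* class forms on N11's (G-ord)@3 rows: the sequel `XGordRankOneZeroCyclotomicThreeLowerKClasses.lean`.

Nothing booked; labels unchanged; O7 / X4♯(G-ord) stay CONSTRUCTION-SHAPED (three typed inputs named).
-/

noncomputable section

open scoped Classical MatrixGroups ModularForm

open CongruenceSubgroup WeierstrassCurve WeierstrassCurve.Affine.Point NumberField IsDedekindDomain
  Literature.NumberTheory.EllipticCurves Literature.NumberTheory.EllipticCurves.ModularForms
  Literature.NumberTheory.EllipticCurves.Rank1Residual
  Literature.NumberTheory.EllipticCurves.Rank1Residual.Typed
  Literature.NumberTheory.EllipticCurves.Delbourgo2002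
  Literature.NumberTheory.GaloisRepresentations

namespace Summit.BirchSwinnertonDyer.Rank1Residual.Additive

section Facts

variable (V : WeierstrassCurve ℚ) [V.IsElliptic] [V.IsGloballyMinimal]
  (W : WeierstrassCurve ℚ) [W.IsElliptic] [W.IsGloballyMinimal]

/- The residual input (⊇/K) for `V` over `K = CyclotomicField 3 ℚ` (module docstring); a section
hypothesis shared by every theorem of this section. -/
variable
    (hLowK : ∀ {κ : ZpExtension (CyclotomicField 3 ℚ) 3}
      {γ : Field.absoluteGaloisGroup (CyclotomicField 3 ℚ)} {N : ℕ} [NeZero N]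
      {f : CuspForm (Gamma0 N) 2},
      κ.IsCyclotomic → κ.IsTopGenerator γ →
      (∃ ζ : ℤ_[3]ˣ, IsOfFinOrder ζ ∧
        ((GaloisRep.cyclotomicCharacter (CyclotomicField 3 ℚ) 3 γ * ζ : ℤ_[3]ˣ) : ℤ_[3]) =
          (cyclotomicGenerator 3 : ℤ_[3])) →
      IsNewformOf V f →
      ∀ (D : (V.baseChange (CyclotomicField 3 ℚ)).SelmerDualData κ γ) (ϖ ϖ' : ℚ),
        (ϖ : ℝ) * V.realPeriodRat = plusPeriod f →
        (ϖ' : ℝ) * V.imaginaryPeriodRat = minusPeriod f →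
        ∀ g ∈ D.charIdeal, ∃ h : IwasawaAlgebra 3,
          iwasawaToPowerSeries 3 g =
            iwasawaToPowerSeries 3 h *
              (PowerSeries.C ((ϖ : ℚ_[3]) * (ϖ' : ℚ_[3])) *
                (padicLFunction f ((unitRoot V 3 : ℤ_[3]) : ℚ_[3]) *
                  padicLFunctionMinusBranch f ((unitRoot V 3 : ℤ_[3]) : ℚ_[3]) 1)))

/- The typed Schneider input `hS1K` for `(V, Tr, Dh)` over `K = CyclotomicField 3 ℚ` (module docstring). -/
variable (Tr : W.toAffine.Point →+ (V.baseChange (CyclotomicField 3 ℚ)).toAffine.Point)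
    (Dh : PAdicHeightData W 3)
    (hS1K : ∀ (κ : ZpExtension (CyclotomicField 3 ℚ) 3) (γ : Field.absoluteGaloisGroup (CyclotomicField 3 ℚ)),
      κ.IsCyclotomic → κ.IsTopGenerator γ →
      (∃ ζ : ℤ_[3]ˣ, IsOfFinOrder ζ ∧
        ((GaloisRep.cyclotomicCharacter (CyclotomicField 3 ℚ) 3 γ * ζ : ℤ_[3]ˣ) : ℤ_[3]) =
          (cyclotomicGenerator 3 : ℤ_[3])) →
      ∀ (D : (V.baseChange (CyclotomicField 3 ℚ)).SelmerDualData κ γ)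
        [Module.Finite (IwasawaAlgebra 3) D.X], D.IsTorsion →
      ∀ (fE : IwasawaAlgebra 3), D.charIdeal = Ideal.span {fE} →
        (V.baseChange (CyclotomicField 3 ℚ)).mordellWeilRank = 1 →
        Finite (AddCommGroup.primaryComponent (V.baseChange (CyclotomicField 3 ℚ)).sha 3) →
      ∀ (Q : (V.baseChange (CyclotomicField 3 ℚ)).toAffine.Point), IsMordellWeilBasis (fun _ : Fin 1 => Q) →
        PowerSeries.X ∣ fE ∧
        ∃ DK : PAdicHeightDataK V 3 (CyclotomicField 3 ℚ),
          (∀ P P' : W.toAffine.Point, DK.pairing (Tr P) (Tr P') = 2 * Dh.pairing P P') ∧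
          ∃ u : ℤ_[3]ˣ,
            ((PowerSeries.coeff 1 fE : ℤ_[3]) : ℚ_[3]) * padicLog 3 (cyclotomicGenerator 3) *
                (Nat.card (AddCommGroup.primaryComponent
                  (V.baseChange (CyclotomicField 3 ℚ)).toAffine.Point 3) : ℚ_[3]) ^ 2 =
              ((u : ℤ_[3]) : ℚ_[3]) * DK.pairing Q Q *
                (3 : ℚ_[3]) ^ (padicValNat 3 (V.baseChange (CyclotomicField 3 ℚ)).tamagawaProduct) *
                (Nat.card (AddCommGroup.primaryComponent
                  ((integralModelInt V).map (Int.castRingHom (ZMod 3))).toAffine.Point 3) : ℚ_[3]) ^ 2 *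
                (Nat.card (AddCommGroup.primaryComponent (V.baseChange (CyclotomicField 3 ℚ)).sha 3) : ℚ_[3]))

include hLowK hS1K

/-- **(S8) from named facts + the typed inputs.** For `V/ℚ` globally minimal, good ordinary at `3`, of
analytic rank `0`, `W = C • V^{(−3)}` globally minimal ADDITIVE at `3` of analytic rank `1` with
`surj(3) ∧ ram(3)` (so `ρ_{V,3^∞}` is onto, `forall_surj_pow_of_twist_pStar_of_surj_of_ram`), a twisting
transport `Tr` doubling Néron–Tate heights, and a height datum `Dh` on `W(ℚ)` with Schneider's
non-degeneracy `hS`: `#Ш_an(V) = q_V`, `#Ш_an(W) = q_W` with **`ord₃ q_V + ord₃ q_W ≤ ord₃ #Ш(V) + ord₃ #Ш(W)`**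
(`Typed.JointLowerBoundAt V W 3`), granted the typed inputs (⊇/K) (`hLowK`), `hS1K`,
`hGZ : BranchPAdicGrossZagierOddAt W 3 Dh` and the named facts Kato Thm. 17.4 (3) over `ℚ(ζ₃)` (`hKato`,
torsion clause), Milne 1972 (`hMilne`), modularity (`hmod`, `hmodD`), GZK (`hGZK`). The core's certificate
`[T¹]L₃(V,ω¹,T) ≠ 0` follows from `hS`, `hGZ` and `L'(W,1) ≠ 0`. [cite: GreenbergLNM1716, §4 p. 110]
[cite: Delbourgo2002, p. 39 (the height)] [cite: Kato2004Asterisque, Thm. 17.4 (3) (p. 273)]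
[cite: Milne1972ArithmeticAV, §1 Thm. 1] -/
theorem XGordRankOneZeroCyclotomicThreeLowerK.jointLowerBoundAt_of_surj_of_ram
    (hKato : Kato2004.charIdeal_dvd_padicLFunction_cyclotomicThree_of_surjective)
    (hMilne : Milne1972.bsdQuotient_baseChange_quadratic_anyModel)
    (hGZK : rank_eq_analyticRank_of_analyticRank_le_one) (hmod : hasEntireLFunction_rat)
    (hmodD : nonempty_modularParametrizationData)
    (C : VariableChange ℚ) (hC : C • V.quadraticTwist (-(3 : ℚ)) = W)
    (hTr : ∀ P : W.toAffine.Point, heightPairing (Tr P) (Tr P) = 2 * heightPairing P P)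
    (hord : IsOrdinaryAt V 3) (hsurj : Surj W 3) (hram : Ram W 3) (hadd : Addv W 3)
    (hrV : V.analyticRank = 0) (hrW : W.analyticRank = 1)
    (hS : SchneiderConjecture Dh) (hGZ : BranchPAdicGrossZagierOddAt W 3 Dh) :
    JointLowerBoundAt V W 3 := by
  haveI : IsCyclotomicExtension {3} ℚ (CyclotomicField 3 ℚ) := CyclotomicField.isCyclotomicExtension 3 ℚ
  set K := CyclotomicField 3 ℚ
  haveI : NeZero (V.conductorNorm ℤ) := ⟨(V.conductorNorm_pos_holds).ne'⟩
  obtain ⟨Dm⟩ := hmodD V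
  have hf : IsNewformOf V Dm.f := Dm.isNewformOf
  obtain ⟨ϖ, -, hϖ, -⟩ := Dm.exists_rat_mul_realPeriodRat_eq_plusPeriod
  obtain ⟨ϖ', -, hϖ'⟩ := exists_rat_mul_imaginaryPeriodRat_eq_minusPeriod Dm
  have hC' : C • V.quadraticTwist (((-((3 : ℕ) : ℤ)) : ℤ) : ℚ) = W := by push_cast; exact hC
  have hsurjV : ∀ n : ℕ, V.HasSurjectiveModNGaloisRep (3 ^ n : ℕ) :=
    forall_surj_pow_of_twist_pStar_of_surj_of_ram 3 V (k := -1) (by norm_num) (Or.inr rfl) C hC' hsurj hram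
  haveI : (V.baseChange K).IsElliptic := by rw [WeierstrassCurve.baseChange]; infer_instance
  -- the certificate `[T¹]B⁻ ≠ 0` from Schneider's non-degeneracy through the Gross–Zagier identity
  have hcert : PowerSeries.coeff 1
      (padicLFunctionMinusBranch Dm.f ((unitRoot V 3 : ℤ_[3]) : ℚ_[3]) 1) ≠ 0 := by
    obtain ⟨hmwW, -⟩ := hGZK W (by rw [hrW])
    have hr1W : W.mordellWeilRank = 1 := by rw [hmwW, hrW]
    have hVW : ∃ C : VariableChange ℚ, C • V.quadraticTwist (-((3 : ℕ) : ℚ)) = W :=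
      ⟨C, by have h := hC; norm_num at h ⊢; exact h⟩
    obtain ⟨u, qW, hlead, hpgz⟩ := hGZ V (by norm_num) hVW ⟨hord.1, hord.2⟩ hf ϖ' hϖ'
    have h32 : (3 / 2 : ℕ) = 1 := by norm_num
    rw [hr1W, pow_one, h32] at hpgz
    have hL : W.leadingLCoeff ≠ 0 := W.leadingLCoeff_ne_zero_holds (hmod W)
    have hΩW : (W.realPeriodRat : ℂ) ≠ 0 := by exact_mod_cast W.realPeriodRat_pos_holds.ne'
    have hRegW : (W.regulator : ℂ) ≠ 0 := by exact_mod_cast (regulator_pos_holds W).ne'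
    have hqW : (qW : ℚ_[3]) ≠ 0 := by
      have hq : qW ≠ 0 := by
        rintro rfl
        apply hL
        rw [hlead]; simp
      exact_mod_cast hq
    obtain ⟨ul, hul⟩ := exists_unit_padicLog_cyclotomicGenerator 3 (by norm_num)
    have hlg0 : padicLog 3 (cyclotomicGenerator 3) ≠ 0 := by
      rw [hul]; exact mul_ne_zero (by norm_num) (coe_units_ne_zero 3 ul)
    intro h0
    have hR : ((u : ℤ_[3]) : ℚ_[3]) * (qW : ℚ_[3]) * padicRegulator Dh = 0 := by
      rw [← hpgz, h0, mul_zero, zero_mul]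
    rcases mul_eq_zero.mp hR with h1 | h1
    · rcases mul_eq_zero.mp h1 with h2 | h2
      · exact coe_units_ne_zero 3 u h2
      · exact hqW h2
    · exact hS h1
  exact XGordRankOneZeroCyclotomicThreeLowerK.exists_padicVal_shaAn_add_le K V W hGZK hmod hMilne C hC Tr hTr
    hord hadd hrV hrW hf ϖ ϖ' hϖ hϖ' Dh hcert hGZ
    (fun κ γ hκ hγ hγ' D ↦
      (hKato V K (V.baseChange K) hord hsurjV ⟨1, one_smul _ _⟩ hκ hγ hγ' hf D ϖ ϖ' hϖ hϖ').1)
    (fun κ γ hκ hγ hγ' D g hg ↦ hLowK hκ hγ hγ' hf D ϖ ϖ' hϖ hϖ' g hg) hS1K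

/-- **`Typed.MissingLowerBoundAt W 3` for the ADDITIVE rank-ONE curve, EVERY ROW (anomalous included)** ⟸
(⊇/K) + `hS1K` + p01's typed GZ + Schneider's rider, with the UPPER half of the rank-ZERO good ordinary
twist `V` DISCHARGED: Wuthrich 2014 Prop. 21 (`hW`; `V` good at `3`, image `surj(3)`, `r_an(V) = 0`).
[cite: Wuthrich2014, Prop. 21 (p. 400)] [cite: GreenbergLNM1716, §4 p. 110] [cite: Miller2011LMS, Def. 1.1] -/
theorem XGordRankOneZeroCyclotomicThreeLowerK.missingLowerBoundAt_of_surj_of_ram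
    (hKato : Kato2004.charIdeal_dvd_padicLFunction_cyclotomicThree_of_surjective)
    (hWu : Wuthrich2014.sha_dvd_analyticSha)
    (hMilne : Milne1972.bsdQuotient_baseChange_quadratic_anyModel)
    (hGZK : rank_eq_analyticRank_of_analyticRank_le_one) (hmod : hasEntireLFunction_rat)
    (hmodD : nonempty_modularParametrizationData)
    (C : VariableChange ℚ) (hC : C • V.quadraticTwist (-(3 : ℚ)) = W)
    (hTr : ∀ P : W.toAffine.Point, heightPairing (Tr P) (Tr P) = 2 * heightPairing P P)
    (hord : IsOrdinaryAt V 3) (hsurj : Surj W 3) (hram : Ram W 3) (hadd : Addv W 3)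
    (hrV : V.analyticRank = 0) (hrW : W.analyticRank = 1)
    (hS : SchneiderConjecture Dh) (hGZ : BranchPAdicGrossZagierOddAt W 3 Dh) :
    MissingLowerBoundAt W 3 := by
  have hJ := XGordRankOneZeroCyclotomicThreeLowerK.jointLowerBoundAt_of_surj_of_ram V W hLowK Tr Dh hS1K
    hKato hMilne hGZK hmod hmodD C hC hTr hord hsurj hram hadd hrV hrW hS hGZ
  have hC' : C • V.quadraticTwist (((-((3 : ℕ) : ℤ)) : ℤ) : ℚ) = W := by push_cast; exact hC
  have hsurjV : V.HasSurjectiveModNGaloisRep 3 := by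
    simpa using forall_surj_pow_of_twist_pStar_of_surj_of_ram 3 V (k := -1) (by norm_num) (Or.inr rfl)
      C hC' hsurj hram 1
  have huV : MissingUpperBoundAt V 3 :=
    missingUpperBoundAt_of_wuthrich V 3 hWu hGZK hmod (by norm_num) hrV
      (WeierstrassCurve.HasGoodReduction.not_hasAdditiveReduction _ hord.1) (Or.inr hsurjV)
  -- swap the pair: `JointLowerBoundAt V W 3 → JointLowerBoundAt W V 3`
  obtain ⟨qV, qW, hqV, hqW, hle⟩ := hJ
  exact missingLowerBoundAt_of_joint_of_upper ⟨qW, qV, hqW, hqV, by linarith⟩ huV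

/-- **Symmetrically: `Typed.MissingLowerBoundAt V 3` for the rank-ZERO good ordinary twist from (⊇/K) +
`hS1K` + typed GZ + the UPPER half of the additive rank-one `W`** (hypothesis `huW`; on X4♯(G-ord)@3 it is
p01's `ClassX4Gord.missingUpperBoundAt_rankOne_of_katoHalf_of_branchPAdicGrossZagierOdd`).
[cite: GreenbergLNM1716, §4 p. 110] [cite: Miller2011LMS, Def. 1.1] -/
theorem XGordRankOneZeroCyclotomicThreeLowerK.missingLowerBoundAt_twist_of_missingUpperBoundAt_of_surj_of_ram
    (hKato : Kato2004.charIdeal_dvd_padicLFunction_cyclotomicThree_of_surjective)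
    (hMilne : Milne1972.bsdQuotient_baseChange_quadratic_anyModel)
    (hGZK : rank_eq_analyticRank_of_analyticRank_le_one) (hmod : hasEntireLFunction_rat)
    (hmodD : nonempty_modularParametrizationData)
    (C : VariableChange ℚ) (hC : C • V.quadraticTwist (-(3 : ℚ)) = W)
    (hTr : ∀ P : W.toAffine.Point, heightPairing (Tr P) (Tr P) = 2 * heightPairing P P)
    (hord : IsOrdinaryAt V 3) (hsurj : Surj W 3) (hram : Ram W 3) (hadd : Addv W 3)
    (hrV : V.analyticRank = 0) (hrW : W.analyticRank = 1)
    (hS : SchneiderConjecture Dh) (hGZ : BranchPAdicGrossZagierOddAt W 3 Dh)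
    (huW : MissingUpperBoundAt W 3) : MissingLowerBoundAt V 3 :=
  missingLowerBoundAt_of_joint_of_upper
    (XGordRankOneZeroCyclotomicThreeLowerK.jointLowerBoundAt_of_surj_of_ram V W hLowK Tr Dh hS1K hKato hMilne
      hGZK hmod hmodD C hC hTr hord hsurj hram hadd hrV hrW hS hGZ) huW

/-- **`BSD(W,3) ∧ BSD(V,3)` on X4♯(G-ord)@3 ∧ `surj ∧ ram`, `r_an(W) = 1`, `r_an(V) = 0`, EVERY ROW
(anomalous included)** ⟸ the typed inputs (⊇/K) (`hLowK`), `hS1K`, `hGZ : BranchPAdicGrossZagierOddAt W 3 Dh`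
and the Schneider rider `hS` at a Delbourgo (B)-datum `Dh` (`hB : LeadingTermClauses W 3 Dh`, supplied per
row by `Delbourgo2002.mainTheorem_three` + ¬CM), plus named facts: Kato Thm. 17.4 (3) over `ℚ(ζ₃)` (`hKato`)
and its half-eigen reading over `ℚ` (`hK`, p01's UPPER half
`ClassX4Gord.missingUpperBoundAt_rankOne_of_katoHalf_of_branchPAdicGrossZagierOdd`), Wuthrich Prop. 21
(`hWu`, UPPER half of `V`), Milne, modularity, GZK. The IMC-version loop of route planner 3's O7-ord@3
matrix, closed on the ANOMALOUS (G-ord) cell as well; nothing booked; O7 stays CONSTRUCTION-SHAPED.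
[cite: Kato2004Asterisque, Thm. 17.4 (3) (p. 273)] [cite: Wuthrich2014, Prop. 21 (p. 400)]
[cite: Delbourgo2002, Theorem (B) (p. 40)] [cite: GreenbergLNM1716, §4 p. 110] [cite: Miller2011LMS, Def. 1.1] -/
theorem XGordRankOneZeroCyclotomicThreeLowerK.bsdp_three_and_twist_of_katoHalf_of_leadingTermClauses_of_surj_of_ram
    (hKato : Kato2004.charIdeal_dvd_padicLFunction_cyclotomicThree_of_surjective)
    (hK : Wuthrich2014.kato_halfEigenCharIdeal_dvd_cyclotomicPrime_of_surjective)
    (hWu : Wuthrich2014.sha_dvd_analyticSha)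
    (hMilne : Milne1972.bsdQuotient_baseChange_quadratic_anyModel)
    (hGZK : rank_eq_analyticRank_of_analyticRank_le_one) (hmod : hasEntireLFunction_rat)
    (hmodD : nonempty_modularParametrizationData)
    (C : VariableChange ℚ) (hC : C • V.quadraticTwist (-(3 : ℚ)) = W)
    (hTr : ∀ P : W.toAffine.Point, heightPairing (Tr P) (Tr P) = 2 * heightPairing P P)
    (hord : IsOrdinaryAt V 3) (hX : ClassX4Gord W 3) (hsurj : Surj W 3) (hram : Ram W 3)
    (hrV : V.analyticRank = 0) (hrW : W.analyticRank = 1)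
    (hB : LeadingTermClauses W 3 Dh) (hS : SchneiderConjecture Dh) (hGZ : BranchPAdicGrossZagierOddAt W 3 Dh) :
    BSDp W 3 ∧ BSDp V 3 := by
  have he : semistabilityIndex W 3 = 2 :=
    semistabilityIndex_eq_two_of_typeG_three W hX.typeGOrd.typeG hX.addv.2
  have huW : MissingUpperBoundAt W 3 :=
    ClassX4Gord.missingUpperBoundAt_rankOne_of_katoHalf_of_branchPAdicGrossZagierOdd hK hGZK hmod hmodD hX
      he (by norm_num) hsurj hrW hB hS hGZ
  have hlW := XGordRankOneZeroCyclotomicThreeLowerK.missingLowerBoundAt_of_surj_of_ram V W hLowK Tr Dh hS1K hKato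
    hWu hMilne hGZK hmod hmodD C hC hTr hord hsurj hram hX.addv.2 hrV hrW hS hGZ
  have hlV := XGordRankOneZeroCyclotomicThreeLowerK.missingLowerBoundAt_twist_of_missingUpperBoundAt_of_surj_of_ram
    V W hLowK Tr Dh hS1K hKato hMilne hGZK hmod hmodD C hC hTr hord hsurj hram hX.addv.2 hrV hrW hS hGZ huW
  have hC' : C • V.quadraticTwist (((-((3 : ℕ) : ℤ)) : ℤ) : ℚ) = W := by push_cast; exact hC
  have hsurjV : V.HasSurjectiveModNGaloisRep 3 := by
    simpa using forall_surj_pow_of_twist_pStar_of_surj_of_ram 3 V (k := -1) (by norm_num) (Or.inr rfl)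
      C hC' hsurj hram 1
  have huV : MissingUpperBoundAt V 3 :=
    missingUpperBoundAt_of_wuthrich V 3 hWu hGZK hmod (by norm_num) hrV
      (WeierstrassCurve.HasGoodReduction.not_hasAdditiveReduction _ hord.1) (Or.inr hsurjV)
  exact ⟨bsdp_of_missingPPartAt W 3 hGZK (by rw [hrW]) (missingPPartAt_of_lower_of_upper W 3 hlW huW),
    bsdp_of_missingPPartAt V 3 hGZK (by rw [hrV]; exact zero_le_one) (missingPPartAt_of_lower_of_upper V 3 hlV huV)⟩

end Facts


end Summit.BirchSwinnertonDyer.Rank1Residual.Additive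

end
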